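import Literature.NumberTheory.Rogawski1990.FinExplicitTransferFactorDockConstancy    -- ★ p841696 F0P3-p01 (g12): the dock twin `hΔθ` (+ ★ EventuallyConst ∕ Nondegenerate ∕ KappaEigenvector, carriers)
import Literature.NumberTheory.Rogawski1990.FinExplicitTransferFactorConjRight       -- ★ `finExplicitDelta_conj_right_all`, `isLocalNormPair_conj_right`
import Literature.NumberTheory.Rogawski1990.FinExplicitTransferFactorConjLeft        -- ★ `finExplicitDelta_conj_left_all`
import Literature.NumberTheory.Automorphic.UnitaryGroupFrameEmbedding               -- ★ `finSum_mulVec_append`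
import HarnessLib

/-!
# `Δ‴_v` IS CONSTANT ON THE MATCHED `ε′`-SIDE CLASSES NEAR `ε_H` — the residual binder `hΔ′` (`stub_S1_hDeltaPrime`) of the S1 dress ★ p842170
# (read in the bad frame `P′`: every matched class conjugate into the pattern `P′·(B ⊕ᶠ u(γ_H))·P′⁻¹` carries the FIXED `u(γ_H)`-eigenvector `P′e₃`)

Topic `NumberTheory/Rogawski1990`; namespace `Literature.NumberTheory.Rogawski1990`.  THEOREMS ONLY (no definition, no instance, no notation, no named fact,
no `sorry`).  Cell `pub/hodgecm-mathlib` (D-0151), crux H413 = stmt-HodgeConjecture-24833, floor-2 line «N6nsGerm», stub `stub_N6nsS1`; LEAD F0P3a-plan (g9) WORD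
T8-130 (2) «`stub_S1_hDeltaPrime` ((Δ-θ′) — dress∕p08)»; seat A-p16 (g26).  HONEST LABEL: HC_CM is proved only modulo the printed citations until rung 0 closes; this file
discharges ONE residual hypothesis of ★ `exists_nhds_stableOrbitalIntegralRel_eq_of_central_singular_of_compactSide` (the S1 dress), nothing printed.

THE MATHEMATICS (the `ε′`-side twin of ★ `exists_nhds_finExplicitDelta_dock_eq`).  `ε_H = (a·1₂, u)` with `u ≠ a` at a non-split `v`; `P′ ∈ GL₃` ANY frame.  Rogawski's
explicit factor on matching pairs is `Δ‴_v(γ_H, γ′) = τ_v(γ_H)·D(γ_H)·κ_v(γ_H, γ′)` (★ `finExplicitDelta_of_isLocalNormPair`).  For `γ_H` near `ε_H` and a matched class `c`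
with `x·(out c)·x⁻¹ = P′·(B ⊕ᶠ u(γ_H))·P′⁻¹` for some `x`, `B`:
* `Δ‴_v(γ_H, out c) = Δ‴_v(γ_H, x·out c·x⁻¹)` (★ `finExplicitDelta_conj_right_all`), and `x·out c·x⁻¹` still matches `γ_H` (★ `isLocalNormPair_conj_right`);
* `b := x·out c·x⁻¹` has the `u(γ_H)`-eigenvector `P′ e₃` (`(B ⊕ᶠ u)·e₃ = u·e₃`, ★ `finSum_mulVec_append`) — a vector that depends on `P′` ONLY; so by ★
  `finKappaAt_eq_ite_of_eigenvector` `κ_v(γ_H, b) = ±1` according as `⟨P′e₃, P′e₃⟩_{H′_v}` is a unit norm — independent of `γ_H` and `c`;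
* `τ_v(γ_H) = τ_v(ε_H)`, `D(γ_H) = D(ε_H)` near `ε_H` (★ `finTau_eventually_eq`, ★ `finWeylRatio_eventually_eq`; `χ_{a·1₂}(u) = (u − a)²` a unit ★ `isUnit_eval_finCharpolyTwo_of_central`).
Hence `Δ‴_v(γ_H, out c) = Δ₁ := τ_v(ε_H)·D(ε_H)·κ₀`. [Rogawski1990 §4.9 p. 55; §4.3 (4.3.2) p. 43; §8.1 Prop. 8.1.3 p. 116; §8.2 Prop. 8.2.1 (a) p. 112.]

* **`exists_const_nhds_finExplicitCollection_Δ_eq_of_frame`** — the dress's `hΔ′` VERBATIM (★ p842024's text with `Q′ := fun γH g => ∃ B, g·P′ = P′·(B ⊕ᶠ u(γH))` β-reduced).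

## References
* [Rogawski1990] J. D. Rogawski, *Automorphic Representations of Unitary Groups in Three Variables*, Ann. of Math. Stud. 123 (1990): §4.3 p. 43; §4.9 pp. 54–55; §8.1 Prop. 8.1.3
  p. 116; §8.2 Prop. 8.2.1 (a) p. 112.
* [LanglandsShelstad1987] R. P. Langlands, D. Shelstad, *On the definition of transfer factors*, Math. Ann. 278 (1987): §1 (κ via `inv(γ_H, γ)`).
-/

set_option autoImplicit false

noncomputable section

open Set Filter Topology Matrix Polynomial NumberField IsDedekindDomain
open scoped MatrixGroups

namespace Literature.NumberTheory.Rogawski1990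

open Literature.NumberTheory.Automorphic Literature.NumberTheory.Automorphic.UnitaryGroup Literature.NumberTheory.GaloisRepresentations

section BadFrameConstancy

variable (L : Type) [Field L] [NumberField L] [IsCMField L] (H' : Matrix (Fin 3) (Fin 3) L) (v : HeightOneSpectrum (𝓞 ↥(maximalRealSubfield L)))

omit [NumberField L] [IsCMField L] in
/-- **`(B ⊕ᶠ D)·e₃ = D₀₀·e₃`**: the last basis vector is an eigenvector of a `2 ⊕ 1` block matrix. [cite: Rogawski1990, §4.8 Case (a) p. 53] -/
private theorem finSum_two_one_mulVec_single_two {R : Type} [CommRing R] (B : Matrix (Fin 2) (Fin 2) R) (D : Matrix (Fin 1) (Fin 1) R) :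
    finSum 2 1 B D *ᵥ Pi.single (2 : Fin (2 + 1)) (1 : R) = (D 0 0) • Pi.single (2 : Fin (2 + 1)) (1 : R) := by
  have h1 : (Pi.single (2 : Fin (2 + 1)) (1 : R)) = Fin.append (0 : Fin 2 → R) (fun _ : Fin 1 => (1 : R)) := by
    ext i; fin_cases i <;> rfl
  have h2 : ((D 0 0) • Pi.single (2 : Fin (2 + 1)) (1 : R)) = Fin.append (0 : Fin 2 → R) (fun _ : Fin 1 => D 0 0) := by
    ext i; fin_cases i <;> simp [Fin.append, Fin.addCases]
  rw [h2, h1, finSum_mulVec_append, Matrix.mulVec_zero]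
  congr 1
  ext i
  have hi : i = 0 := Subsingleton.elim _ _
  subst hi
  simp [Matrix.mulVec, dotProduct]

omit [NumberField L] [IsCMField L] in
/-- An invertible matrix kills no non-zero vector. [folklore] -/
private theorem mulVec_ne_zero_of_ne_zero'' {n : Type} [Fintype n] [DecidableEq n] {R : Type} [CommRing R] (g : GL n R) {p : n → R} (hp : p ≠ 0) :
    g.val *ᵥ p ≠ 0 := by
  intro h0
  apply hp
  have h1 : (g⁻¹).val *ᵥ (g.val *ᵥ p) = p := by
    rw [mulVec_mulVec, ← Units.val_mul, inv_mul_cancel, Units.val_one, one_mulVec]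
  rw [← h1, h0, mulVec_zero]

open scoped Classical in
/-- **`Δ‴_v` IS CONSTANT ON THE MATCHED `ε′`-SIDE CLASSES NEAR `ε_H`** — the residual binder `hΔ′` of the S1 dress ★
`exists_nhds_stableOrbitalIntegralRel_eq_of_central_singular_of_compactSide` VERBATIM, for ANY frame `P′`.  See the module docstring.
[cite: Rogawski1990, §4.9 p. 55; §4.3 (4.3.2) p. 43; §8.1 Prop. 8.1.3 p. 116; §8.2 Prop. 8.2.1 (a) p. 112] [cite: LanglandsShelstad1987, §1] -/
theorem exists_const_nhds_finExplicitCollection_Δ_eq_of_frame (w : PlacesOver L v) (hw : IsCMField.complexConj L • w.1 = w.1) (μ : HeckeCharacter L)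
    (εH : ((cmDatum L 2 (Matrix.of fun i j : Fin 2 => if i.val + j.val + 1 = 2 then (1 : L) else 0)).Local v ×
      (cmDatum L 1 (Matrix.of fun i j : Fin 1 => if i.val + j.val + 1 = 1 then (1 : L) else 0)).Local v)) (a : LocalRing L v)
    (ha : (εH.1.val.val : Matrix (Fin 2) (Fin 2) (LocalRing L v)) = a • (1 : Matrix (Fin 2) (Fin 2) (LocalRing L v)))
    (hu : (εH.2.val.val : Matrix (Fin 1) (Fin 1) (LocalRing L v)) 0 0 ≠ a)
    (P' : GL (Fin (2 + 1)) (LocalRing L v)) :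
    ∃ Δ₁ : ℂ, ∃ VΔ ∈ 𝓝 εH, ∀ γH ∈ VΔ, IsLocalGRegular L v γH → ∀ c : ConjClasses ((cmDatum L 3 H').Local v), (∃ x : ((cmDatum L 3 H').Local v), (∃ B : Matrix (Fin 2) (Fin 2) (LocalRing L v), ((x * Quotient.out c * x⁻¹).val.val : Matrix (Fin 3) (Fin 3) (LocalRing L v)) * P'.val = P'.val * finSum 2 1 B (γH.2.val.val : Matrix (Fin 1) (Fin 1) (LocalRing L v)))) →
        IsLocalNormPair L H' v γH (Quotient.out c) → ((finExplicitCollection L H' μ (finExplicitDelta_conj_left_all L H' μ) (finExplicitDelta_conj_right_all L H' μ)) v).Δ γH (Quotient.out c) = Δ₁ := by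
  haveI hv : Subsingleton (PlacesOver L v) := PlacesOver.subsingleton_of_smul_eq (IsCMField.complexConj L) (IsCMField.complexConj_ne_one L) w hw
  have hu₀ : IsUnit ((finCharpolyTwo L v εH).eval (finGammaTwo L v εH)) := isUnit_eval_finCharpolyTwo_of_central L v w hw εH a ha hu
  -- `τ`, `D` eventually constant at `ε_H`
  obtain ⟨VΔ, hVΔ, hV⟩ := ((finTau_eventually_eq L v μ hu₀).and (finWeylRatio_eventually_eq L v hu₀)).exists_mem
  -- the fixed vector `P′ e₃` and the sign `κ₀` read on it
  set p' : Fin 3 → LocalRing L v := P'.val *ᵥ Pi.single (2 : Fin (2 + 1)) (1 : LocalRing L v) with hp'def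
  have hne : p' ≠ 0 := mulVec_ne_zero_of_ne_zero'' P' (by simp)
  refine ⟨finTau L v εH μ * (finWeylRatio L v εH : ℂ) *
      (((if ∃ z : LocalRing L v, IsUnit z ∧
          (∑ i : Fin 3, ∑ k : Fin 3, conjLocal L (IsCMField.complexConj L) v (p' i) *
            ((adelicForm L 3 H').map (adeleToLocal L v)) i k * p' k) =
          z * conjLocal L (IsCMField.complexConj L) v z then (1 : ℤ) else -1 : ℤ) : ℂ)), VΔ, hVΔ, ?_⟩
  rintro γH hγ hreg c ⟨x, B, hxB⟩ hm
  obtain ⟨hτ, hD⟩ := hV γH hγ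
  -- move to the conjugate `b := x·(out c)·x⁻¹` in the frame
  have hmb : IsLocalNormPair L H' v γH (x * Quotient.out c * x⁻¹) :=
    (isLocalNormPair_conj_right (L := L) (v := v) (H' := H') (a := γH) (b := Quotient.out c) (y := x)).2 hm
  have hΔ : ((finExplicitCollection L H' μ (finExplicitDelta_conj_left_all L H' μ) (finExplicitDelta_conj_right_all L H' μ)) v).Δ γH (Quotient.out c) =
      finExplicitDelta L v H' γH μ (x * Quotient.out c * x⁻¹) := by
    rw [finExplicitCollection_Δ, finExplicitDelta_conj_right_all L H' μ v γH (Quotient.out c) x]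
  -- the common eigenvector `P′ e₃`, eigenvalue `u(γ_H)`
  have hp : ((x * Quotient.out c * x⁻¹).val.val : Matrix (Fin 3) (Fin 3) (LocalRing L v)) *ᵥ p' = finGammaTwo L v γH • p' := by
    rw [hp'def, mulVec_mulVec, hxB, ← mulVec_mulVec, finSum_two_one_mulVec_single_two, mulVec_smul]
    rfl
  have hκ := finKappaAt_eq_ite_of_eigenvector L v H' γH (x * Quotient.out c * x⁻¹) hv hmb
    (isUnit_eval_finCharpolyTwo_of_isLocalGRegular (L := L) (v := v) (a := γH) hreg) hp hne
  rw [hΔ, finExplicitDelta_of_isLocalNormPair L v H' γH μ hmb, hτ, hD, hκ]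

end BadFrameConstancy

end Literature.NumberTheory.Rogawski1990
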